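import Summits.ResolutionOfSingularities.ResolutionOfSingularities.Theorems.WeightedInvariantWeightedThesisHypersurfaceModelProjection
import Summits.ResolutionOfSingularities.ResolutionOfSingularities.Theorems.WeightedInvariantWeightedThesisHypersurfaceModelFieldCore
import Literature.AlgebraicGeometry.Resolution.LinearProjectionVertex
import Mathlib.Data.Fin.Tuple.Take

/-!
# `WeightedInvariant.WeightedThesis`, line `datum-glued-split`, stub 5a (hypersurface models over
# infinite perfect fields), IV: the assembly from the three registered sub-stubs

Fourth file for `stub_hypersurfaceModel` (crux `WeightedThesis`, stmt-ResolutionOfSingularities-0569;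
lead a1, RESHAPE 3, 2026-08-17). PROVED here, with the three sub-stubs of the skeleton
(`stub_functionFieldKaehler`, `stub_formFnLinearGenerates`, `stub_genericFormsNoCommonZero`) taken as
HYPOTHESES (their statements verbatim), the conclusion of `stub_hypersurfaceModel_infinite`:
every integral closed `X ⊆ ℙⁿ_k` over an infinite perfect field `k` has a hypersurface model.

The choice of the linear forms `t₀, …, t_{d+1}` (`d = dim X`) is sequential and generic
(`stub_genericFormsNoCommonZero` supplies the sequence together with "no common zero of `t₀,…,t_d`"
and "`t₀ ≢ 0` on `X`"): `t₁/t₀, …, t_d/t₀` are chosen with linearly independent differentials in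
`Ω[K(X)⁄k]` (generic by `FieldCore.isGeneric_D_not_mem_span`, because `dim Ω[K(X)⁄k] = d` —
`stub_functionFieldKaehler`, `k` perfect — and the ratios of linear forms generate `K(X)` —
`stub_formFnLinearGenerates`), hence form a separating transcendence basis, and `t_{d+1}/t₀` is
chosen primitive for the finite separable extension `K(X)/k(t₁/t₀,…,t_d/t₀)`
(`FieldCore.isGeneric_adjoin_simple_eq_top`). Then `K(X) = k(t_a/t₀ : a ≤ d+1)` and the landed
`hypersurfaceModel_of_linearForms` (file II) gives the model. [Kollár 2007, proof of Prop. 2.48;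
Hartshorne I Prop. 4.9]
-/

noncomputable section

set_option linter.dupNamespace false -- mandated namespace of this single-conjunct summit

open CategoryTheory AlgebraicGeometry
open Literature.AlgebraicGeometry.Resolution Literature.AlgebraicGeometry.Motives

namespace Summit.ResolutionOfSingularities.ResolutionOfSingularities.Theorems.WeightedThesis.HypersurfaceModel

/-- **Hypersurface models over infinite perfect fields, from the three sub-stubs** (their registered
statements verbatim as hypotheses `h1` = `stub_functionFieldKaehler`, `h2` = `stub_formFnLinearGenerates`,
`h3` = `stub_genericFormsNoCommonZero`): every integral closed `X ⊆ ℙⁿ_k`, `k` infinite perfect, admits a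
finite birational morphism onto an integral hypersurface (locally principal ideal) of a smooth separated
quasi-compact `k`-scheme. [cite: Kollar2007, Prop. 2.48 (proof); Hartshorne1977, I Prop. 4.9] -/
theorem hypersurfaceModel_infinite_of_stubs : (∀ (k : Type) [Field k] [PerfectField k] (X : AlgebraicGeometry.Scheme.{0}) [AlgebraicGeometry.IsIntegral X] (f : X ⟶ AlgebraicGeometry.Spec (.of k)) [AlgebraicGeometry.LocallyOfFiniteType f] [AlgebraicGeometry.QuasiCompact f] [Algebra k X.functionField], algebraMap k X.functionField = (X.presheaf.germ ⊤ (genericPoint X) trivial).hom.comp (f.appTop.hom.comp (AlgebraicGeometry.Scheme.ΓSpecIso (.of k)).inv.hom) → Algebra.EssFiniteType k X.functionField ∧ Module.Finite X.functionField (Ω[X.functionField⁄k]) ∧ ∃ d : ℕ, topologicalKrullDim X = d ∧ Module.finrank X.functionField (Ω[X.functionField⁄k]) = d) → (∀ (k : Type) [Field k] (n : ℕ) (X : AlgebraicGeometry.Scheme.{0}) [AlgebraicGeometry.IsIntegral X] (ι : X ⟶ (Literature.AlgebraicGeometry.Motives.projectiveSpace n k).left) [AlgebraicGeometry.IsClosedImmersion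 ι] [Algebra k X.functionField], algebraMap k X.functionField = (X.presheaf.germ ⊤ (genericPoint X) trivial).hom.comp ((ι ≫ (Literature.AlgebraicGeometry.Motives.projectiveSpace n k).hom).appTop.hom.comp (AlgebraicGeometry.Scheme.ΓSpecIso (.of k)).inv.hom) → ∃ V : (Fin (n + 1) → k) →ₗ[k] X.functionField, (∀ c, V c = Literature.AlgebraicGeometry.Resolution.LinSec.formFn ι c) ∧ ∀ a₀ : Fin (n + 1) → k, Literature.AlgebraicGeometry.Resolution.LinSec.formFn ι a₀ ≠ 0 → IntermediateField.adjoin k (Set.range fun c : Fin (n + 1) → k => V c / Literature.AlgebraicGeometry.Resolution.LinSec.formFn ι a₀) = ⊤) → (∀ (k : Type) [Field k] [Infinite k] (n : ℕ) (X : AlgebraicGeometry.Scheme.{0}) [AlgebraicGeometry.IsIntegral X] (ι : X ⟶ (Literature.AlgebraicGeometry.Motives.projectiveSpace n k).left) [AlgebraicGeometry.IsClosedImmersion ι] (d : ℕ), topologicalKrullDim X = d → ∀ (P : ∀ j : ℕ, (Fin j → Fin (n + 1) → k) → (Fin (n + 1) → k) → Prop), (∀ (j : ℕ) (a : Fin j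 → Fin (n + 1) → k), Literature.AlgebraicGeometry.Resolution.IsGeneric (P j a)) → ∃ t : Fin (d + 1 + 1) → Fin (n + 1) → k, (∀ (j : ℕ) (hj : j < d + 1 + 1), P j (Fin.take j hj.le t) (t ⟨j, hj⟩)) ∧ Literature.AlgebraicGeometry.Resolution.LinSec.NoCommonZero ι (Literature.AlgebraicGeometry.Resolution.LinSec.tInit t) ∧ Literature.AlgebraicGeometry.Resolution.LinSec.formFn ι (t 0) ≠ 0) → ∀ (k : Type) [Field k] [PerfectField k] [Infinite k] (n : ℕ) (X : AlgebraicGeometry.Scheme.{0}) (ι : X ⟶ (Literature.AlgebraicGeometry.Motives.projectiveSpace n k).left), AlgebraicGeometry.IsClosedImmersion ι → AlgebraicGeometry.IsIntegral X → ∃ (Y H : AlgebraicGeometry.Scheme.{0}) (g : Y ⟶ AlgebraicGeometry.Spec (.of k)) (j : H ⟶ Y) (φ : X ⟶ H), AlgebraicGeometry.Smooth g ∧ AlgebraicGeometry.IsSeparated g ∧ AlgebraicGeometry.QuasiCompact g ∧ AlgebraicGeometry.IsClosedImmersion j ∧ AlgebraicGeometry.IsIntegral H ∧ (∀ y : Y,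 ∃ U : Y.affineOpens, y ∈ (U : Y.Opens) ∧ (j.ker.ideal U).IsPrincipal) ∧ AlgebraicGeometry.IsFinite φ ∧ Literature.AlgebraicGeometry.Resolution.IsBirational φ := by
  intro h1 h2 h3 k _ _ _ n X ι hι hX
  haveI := hι
  haveI := hX
  classical
  -- the `k`-algebra structure on `K(X)`
  let φk : k →+* X.functionField := (X.presheaf.germ ⊤ (genericPoint X) trivial).hom.comp
    ((ι ≫ (Literature.AlgebraicGeometry.Motives.projectiveSpace n k).hom).appTop.hom.comp
      (AlgebraicGeometry.Scheme.ΓSpecIso (.of k)).inv.hom)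
  letI : Algebra k X.functionField := φk.toAlgebra
  have halg : algebraMap k X.functionField = φk := rfl
  -- F1: `Ω[K(X)⁄k]` has dimension `d = dim X`
  obtain ⟨hEss, hFin, d, hdim, hrank⟩ := h1 k X
    (ι ≫ (Literature.AlgebraicGeometry.Motives.projectiveSpace n k).hom) halg
  haveI := hEss
  haveI := hFin
  -- F2: the linear map of forms, whose ratios generate `K(X)`
  obtain ⟨V, hV, hgenV⟩ := h2 k n X ι halg
  -- the generic side conditions: given the denominator form `a0` (non-zero on `X`) and the previous
  -- numerator forms `as : Fin m → _`, the next form `b` has `d(V b / t₀)` off the span of the previous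
  -- differentials while `m < d`, and `V b / t₀` primitive over `k(previous ratios)` when `m = d`
  let Dk : X.functionField → Ω[X.functionField⁄k] := fun x => KaehlerDifferential.D k X.functionField x
  let Q : (Fin (n + 1) → k) → (m : ℕ) → (Fin m → Fin (n + 1) → k) → (Fin (n + 1) → k) → Prop :=
    fun a0 m as b =>
      LinSec.formFn ι a0 ≠ 0 →
        (m < d → LinearIndependent X.functionField (fun i : Fin m => Dk (V (as i) / LinSec.formFn ι a0)) →
          Dk (V b / LinSec.formFn ι a0) ∉ Submodule.span X.functionField
            (Set.range fun i : Fin m => Dk (V (as i) / LinSec.formFn ι a0))) ∧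
        (m = d → LinearIndependent X.functionField (fun i : Fin m => Dk (V (as i) / LinSec.formFn ι a0)) →
          IntermediateField.adjoin (IntermediateField.adjoin k
            (Set.range fun i : Fin m => V (as i) / LinSec.formFn ι a0)) {V b / LinSec.formFn ι a0} = ⊤)
  have hQ : ∀ (a0 : Fin (n + 1) → k) (m : ℕ) (as : Fin m → Fin (n + 1) → k), IsGeneric (Q a0 m as) := by
    intro a0 m as
    by_cases h0 : LinSec.formFn ι a0 = 0
    · exact IsGeneric.of_forall fun b hne => absurd h0 hne
    have hgen0 := hgenV a0 h0
    have hA : IsGeneric fun b : Fin (n + 1) → k =>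
        m < d → LinearIndependent X.functionField (fun i : Fin m => Dk (V (as i) / LinSec.formFn ι a0)) →
          Dk (V b / LinSec.formFn ι a0) ∉ Submodule.span X.functionField
            (Set.range fun i : Fin m => Dk (V (as i) / LinSec.formFn ι a0)) := by
      by_cases hmd : m < d
      · have hm : m < Module.finrank X.functionField (Ω[X.functionField⁄k]) := by rw [hrank]; exact hmd
        exact (FieldCore.isGeneric_D_not_mem_span V (LinSec.formFn ι a0) hgen0
          (fun i : Fin m => V (as i) / LinSec.formFn ι a0) hm).mono fun b hb _ _ => hb
      · exact IsGeneric.of_forall fun b h => absurd h hmd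
    have hB : IsGeneric fun b : Fin (n + 1) → k =>
        m = d → LinearIndependent X.functionField (fun i : Fin m => Dk (V (as i) / LinSec.formFn ι a0)) →
          IntermediateField.adjoin (IntermediateField.adjoin k
            (Set.range fun i : Fin m => V (as i) / LinSec.formFn ι a0)) {V b / LinSec.formFn ι a0} = ⊤ := by
      by_cases hmd : m = d
      · by_cases hli : LinearIndependent X.functionField
            (fun i : Fin m => Dk (V (as i) / LinSec.formFn ι a0))
        · have hd' : Module.finrank X.functionField (Ω[X.functionField⁄k]) = m := by rw [hrank, hmd]
          exact (FieldCore.isGeneric_adjoin_simple_eq_top V (LinSec.formFn ι a0) hgen0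
            (fun i : Fin m => V (as i) / LinSec.formFn ι a0) hli hd').mono fun b hb _ _ => hb
        · exact IsGeneric.of_forall fun b _ h => absurd h hli
      · exact IsGeneric.of_forall fun b h => absurd h hmd
    exact (hA.and hB).mono fun b hb _ => hb
  let P : ∀ j : ℕ, (Fin j → Fin (n + 1) → k) → (Fin (n + 1) → k) → Prop := fun j a b =>
    ∀ hj : 0 < j, Q (a ⟨0, hj⟩) (j - 1) (fun i : Fin (j - 1) => a ⟨i.1 + 1, by omega⟩) b
  have hP : ∀ (j : ℕ) (a : Fin j → Fin (n + 1) → k), IsGeneric (P j a) := by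
    intro j a
    by_cases hj : 0 < j
    · exact (hQ (a ⟨0, hj⟩) (j - 1) (fun i : Fin (j - 1) => a ⟨i.1 + 1, by omega⟩)).mono
        fun b hb _ => hb
    · exact IsGeneric.of_forall fun b hj' => absurd hj' hj
  -- F3: the sequence of forms
  obtain ⟨t, ht, hbpf, ht0⟩ := h3 k n X ι d hdim P hP
  -- consequences along the sequence
  have hstep : ∀ (m : ℕ) (hm : m ≤ d),
      Q (t 0) m (fun i : Fin m => t ⟨i.1 + 1, by omega⟩) (t ⟨m + 1, by omega⟩) := by
    intro m hm
    exact ht (m + 1) (by omega) (Nat.succ_pos m)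
  -- the ratios `t₁/t₀, …, t_d/t₀` have independent differentials
  have hli : ∀ (m : ℕ) (hm : m ≤ d), LinearIndependent X.functionField
      (fun i : Fin m => Dk (V (t ⟨i.1 + 1, by omega⟩) / LinSec.formFn ι (t 0))) := by
    intro m
    induction m with
    | zero => intro _; exact linearIndependent_empty_type
    | succ m ih =>
      intro hm
      have hnot := (hstep m (by omega) ht0).1 (by omega) (ih (by omega))
      have e : (fun i : Fin (m + 1) => Dk (V (t ⟨i.1 + 1, by omega⟩) / LinSec.formFn ι (t 0))) =
          Fin.snoc (fun i : Fin m => Dk (V (t ⟨i.1 + 1, by omega⟩) / LinSec.formFn ι (t 0)))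
            (Dk (V (t ⟨m + 1, by omega⟩) / LinSec.formFn ι (t 0))) := by
        funext i
        refine Fin.lastCases ?_ (fun i => ?_) i
        · simp only [Fin.snoc_last, Fin.val_last]
        · simp only [Fin.snoc_castSucc, Fin.val_castSucc]
      rw [e, linearIndependent_finSnoc]
      exact ⟨ih (by omega), hnot⟩
  -- `t_{d+1}/t₀` is a primitive element over `k(t₁/t₀, …, t_d/t₀)`
  have hprim := (hstep d le_rfl ht0).2 rfl (hli d le_rfl)
  -- hence `K(X) = k(t_a/t₀ : 1 ≤ a ≤ d + 1)`
  have hgen : Subfield.closure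
      (Set.range ((X.presheaf.germ ⊤ (genericPoint X) trivial).hom.comp
        ((ι ≫ (Literature.AlgebraicGeometry.Motives.projectiveSpace n k).hom).appTop.hom.comp
          (AlgebraicGeometry.Scheme.ΓSpecIso (.of k)).inv.hom)) ∪
        Set.range (fun a : Fin (d + 1) => LinSec.formFn ι (t a.succ) / LinSec.formFn ι (t 0))) = ⊤ := by
    -- the set of all ratios contains the previous ones and the last one
    set R : Set X.functionField :=
      Set.range (fun a : Fin (d + 1) => LinSec.formFn ι (t a.succ) / LinSec.formFn ι (t 0)) with hR
    have hsub : (Set.range fun i : Fin d => V (t ⟨i.1 + 1, by omega⟩) / LinSec.formFn ι (t 0)) ∪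
        {V (t ⟨d + 1, by omega⟩) / LinSec.formFn ι (t 0)} ⊆ R := by
      rintro x (⟨i, rfl⟩ | hx)
      · refine ⟨⟨i.1, by omega⟩, ?_⟩
        simp only [hV]
        rfl
      · rw [Set.mem_singleton_iff] at hx
        subst hx
        refine ⟨Fin.last d, ?_⟩
        simp only [hV]
        rfl
    have htop : IntermediateField.adjoin k R = ⊤ := by
      rw [eq_top_iff]
      have h1 : IntermediateField.adjoin k
          ((Set.range fun i : Fin d => V (t ⟨i.1 + 1, by omega⟩) / LinSec.formFn ι (t 0)) ∪
            {V (t ⟨d + 1, by omega⟩) / LinSec.formFn ι (t 0)}) = ⊤ := by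
        rw [← IntermediateField.adjoin_adjoin_left, hprim, IntermediateField.restrictScalars_top]
      rw [← h1]
      exact IntermediateField.adjoin.mono k _ _ hsub
    have h2 := congrArg IntermediateField.toSubfield htop
    rw [IntermediateField.adjoin_toSubfield] at h2
    exact h2
  exact stub_hypersurfaceModel_of_linearForms k n X ι d t hbpf ht0 hdim hgen

end Summit.ResolutionOfSingularities.ResolutionOfSingularities.Theorems.WeightedThesis.HypersurfaceModel

end
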